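import Summits.MatrixMultiplication.MatrixMultiplication.Theorems.SoloInformedOrbitModel

/-!
# The cyclic model for a general multiplier group — generic columns freeze the twist ((B3)_m)

[this work, theoremB2 §8.4d REMARK (B3)_m].  Counting corollary of `sign_trichotomy`: in the model over
a field `F` with multipliers in a finite set `U ⊆ Fˣ`, fix a popular `a`-class `α ≠ 0`, a second
column `j` of `a` (common class `αj` on the rows considered) and a column `k` of `c` (base value `l`);
every row `i` reads `αj + x_i v − y_i (α + s_i l) = 0` with `x_i, y_i, s_i ∈ U`, `s_i` the twist of
`c(k,i)`.  If `l` avoids the `≤ |U|⁶` values `badL U αj α` and `αj` avoids the `≤ |U|⁴` values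
`badA U α`, then ALL rows carry the same twist `s_i` — the base pattern is frozen at column `k`
(for `m = 2` this is SIGN RIGIDITY, `CyclicModelGauge.sign_rigidity_pm`, with `B₂ = 3` bad values).
-/

namespace Summit.MatrixMultiplication.MatrixMultiplication.Theorems.TwistedTPP

open Finset

variable {F : Type*} [Field F] [DecidableEq F]

/-- The bad base values for (B3)_m: `l = −((x'−x)αj + (xy'−x'y)α)/(xy's' − x'ys)` over unit sextuples
with non-vanishing `l`-coefficient (at most `|U|⁶` values). -/
noncomputable def badL (U : Finset F) (αj α : F) : Finset F :=
  (((U ×ˢ U) ×ˢ (U ×ˢ U)) ×ˢ (U ×ˢ U)).image fun p =>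
    -((p.1.1.2 - p.1.1.1) * αj + (p.1.1.1 * p.1.2.2 - p.1.1.2 * p.1.2.1) * α) /
      (p.1.1.1 * p.1.2.2 * p.2.2 - p.1.1.2 * p.1.2.1 * p.2.1)

/-- The bad second-column classes for (B3)_m: `αj = −(xy'−x'y)α/(x'−x)` over unit quadruples with
`x' ≠ x` (at most `|U|⁴` values). -/
noncomputable def badA (U : Finset F) (α : F) : Finset F :=
  ((U ×ˢ U) ×ˢ (U ×ˢ U)).image fun p =>
    -((p.1.1 * p.2.2 - p.1.2 * p.2.1) * α) / (p.1.2 - p.1.1)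

/-- `|badL| ≤ |U|⁶`. -/
theorem card_badL_le (U : Finset F) (αj α : F) :
    (badL U αj α).card ≤ U.card ^ 6 :=
  card_image_le.trans (le_of_eq (by simp only [card_product]; ring))

/-- `|badA| ≤ |U|⁴`. -/
theorem card_badA_le (U : Finset F) (α : F) : (badA U α).card ≤ U.card ^ 4 :=
  card_image_le.trans (le_of_eq (by simp only [card_product]; ring))

/-- **(B3)_m — a generic second column freezes the twist.** Rows `i` reading
`αj + x_i v − y_i (α + s_i l) = 0` with `x_i, y_i, s_i ∈ U ∌ 0`, `α ≠ 0`, `l ∉ badL U αj α` and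
`αj ∉ badA U α` all have the same twist `s_i`. -/
theorem twist_constant_of_generic {I : Type*} (U : Finset F) (hU0 : (0 : F) ∉ U) (x y s : I → F)
    (hx : ∀ i, x i ∈ U) (hy : ∀ i, y i ∈ U) (hs : ∀ i, s i ∈ U) {αj α l v : F}
    (he : ∀ i, αj + x i * v - y i * (α + s i * l) = 0) (hα : α ≠ 0)
    (hl : l ∉ badL U αj α) (hαj : αj ∉ badA U α) (i i' : I) : s i = s i' := by
  by_contra hne
  have hx0 : x i ≠ 0 := fun h => hU0 (h ▸ hx i)
  have hy0 : y i ≠ 0 := fun h => hU0 (h ▸ hy i)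
  rcases sign_trichotomy (he i) (he i') hne hx0 hy0 with h | ⟨hd, hrel⟩ | ⟨_, hxx, hrel⟩
  · exact hα h
  · apply hl
    rw [badL, mem_image]
    refine ⟨(((x i, x i'), (y i, y i')), (s i, s i')), ?_, ?_⟩
    · simp only [mem_product]
      exact ⟨⟨⟨hx i, hx i'⟩, hy i, hy i'⟩, hs i, hs i'⟩
    · rw [div_eq_iff hd]
      linear_combination -hrel
  · apply hαj
    rw [badA, mem_image]
    refine ⟨((x i, x i'), (y i, y i')), ?_, ?_⟩
    · simp only [mem_product]
      exact ⟨⟨hx i, hx i'⟩, hy i, hy i'⟩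
    · rw [div_eq_iff hxx]
      linear_combination -hrel

/-! ### The concrete frame: multipliers = a subgroup of units of a field

For `U : Subgroup Fˣ` Mathlib's instances make `OrbitModel U G F` the cyclic model with multiplier
group `U` acting on `S = F` by multiplication (for `F = 𝔽_q`, `U = μ_m` this is the model of §8.4d), and
orbit classes are "equal up to a factor in `U`". -/

omit [DecidableEq F] in
/-- Orbit classes under a subgroup of units: `u ∼ w ↔ z·u = w` for some `z ∈ U`. -/
theorem orb_units_iff (U : Subgroup Fˣ) (u w : F) :
    OrbitModel.orb (M := U) u w ↔ ∃ z : Fˣ, z ∈ U ∧ (z : F) * u = w := by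
  constructor
  · rintro ⟨z, hz⟩
    exact ⟨z, z.2, by rw [← hz]; rfl⟩
  · rintro ⟨z, hzU, hz⟩
    exact ⟨⟨z, hzU⟩, by rw [← hz]; rfl⟩

omit [DecidableEq F] in
/-- 1D-injectivity in the concrete frame (specialisation of `OrbitModel.a_injective_on_lines`): two
`a`-cells on a line `i + j = const` that agree up to a factor in `U` coincide. -/
theorem a_injective_on_lines_units {G : Type*} [AddCommGroup G] (U : Subgroup Fˣ)
    (R : OrbitModel U G F) {i j i' j' : G} (hline : i + j = i' + j')
    (h : ∃ z : Fˣ, z ∈ U ∧ (z : F) * R.a i j = R.a i' j') : i = i' ∧ j = j' :=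
  R.a_injective_on_lines hline ((orb_units_iff U _ _).mpr h)

end Summit.MatrixMultiplication.MatrixMultiplication.Theorems.TwistedTPP
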